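import Mathlib
import HarnessLib
import Literature.MathematicalPhysics.QuantumManyBody.LangevinGenerator
import Literature.MathematicalPhysics.QuantumManyBody.PeriodicConfigLaplacian
import Summits.AtomisticToContinuum.BoseEinsteinCondensation.Theorems.BECConjugateDominationInfraredMinimumUncertaintyWeakEulerLagrange

/-!
# Route `BECNewtonPolicyIteration` — support item `PolicyImprovementIdentity`
# (stmt-AtomisticToContinuum-9319), part 1/5: the ground-state representation on the torus in
# logarithmic variables

Helper file (`--supports stmt-AtomisticToContinuum-9319`). The item is informal on the ledger (no
route decl), so nothing in this series closes it; the series proves its content (i)–(iii) and packages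
it as `PolicyImprovement.policyImprovementIdentity(_of_continuous)` in part 5/5,
`BECNewtonPolicyIterationPolicyImprovementIdentity.lean`.

* `integral_sum_norm_sq_covDeriv` — for `S ∈ C²` lattice periodic (real) and `Φ ∈ C¹` periodic
  (complex) on the `N`-particle torus of side `L > 0`,
  `∫_{cell} ∑_{i,a} |∂_{i,a}Φ + Φ ∂_{i,a}S|² = ∫_{cell} |∇Φ|² - ∫_{cell} (ΔS - |∇S|²) |Φ|²`.
  This is the ground-state (Jacobi / Barta / Bakry–Émery) representation of the kinetic energy
  relative to the positive function `F = e^{-S}`, whose local kinetic energy is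
  `-(ΔF)/F = ΔS - |∇S|² = localKinetic S` (`LangevinGenerator.lean`); in logarithmic variables it
  needs no division and exactly one integration by parts on the torus
  (`integral_cellN_pderiv_eq_zero` applied to the flux `|Φ|² ∂_{i,a}S`). It is the common source of
  Barta's inequality (part 2/5) and of the Rayleigh quotient of `e^{-S}` (part 2/5).

References: R. A. Howard, *Dynamic Programming and Markov Processes* (1960) (policy improvement);
M. L. Puterman, S. L. Brumelle, Math. Oper. Res. 4 (1979) 60 (policy iteration = Newton–Kantorovich);
C. J. Holland, CPAM 31 (1978) 509 (logarithmic transform; min–max for the principal eigenvalue);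
J. Barta, C. R. Acad. Sci. Paris 204 (1937) 472 (Barta's inequality `inf (Hφ)/φ ≤ E₀`, `φ > 0`);
W. Thirring, *Quantum Mathematical Physics*, §3.5; [ReedSimonIV1978] §XIII.12; [BakryGentilLedoux2014]
§1.11.3 (`Γ`-calculus, Green's identity); [KipnisLandim1999] App. 1 §6 (weak Poisson equation);
[Fournais2020] (1.1)–(1.2) (the periodic problem).
-/

noncomputable section

open MeasureTheory Filter Set
open scoped ENNReal NNReal Topology InnerProductSpace ComplexConjugate BigOperators

namespace Summit.AtomisticToContinuum.BoseEinsteinCondensation.Theorems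

open Literature.MathematicalPhysics.QuantumManyBody.BoseGas

namespace PolicyImprovement

open ImuWeakEulerLagrange (integrableOn_toReal_interaction_mul periodicForm_eq_ofReal
  lintegral_nnnorm_sq_eq_ofReal)

variable {N : ℕ} {L : ℝ} {v : ℝ → ℝ≥0∞} {Cw : ℝ≥0∞}

/-- The coordinate unit vector `e_{i,a}` of `(ℝ³)^N` (particle `i`, axis `a`), local notation. -/
local notation3 "𝐞[" i ", " a "]" => (Pi.single i (EuclideanSpace.single a (1 : ℝ)) : Config _)

/-! ### Pointwise algebra -/

/-- `‖z + w s‖² = ‖z‖² + 2 s ⟪w, z⟫_ℝ + s² ‖w‖²` for complex `z, w` and real `s` (the value of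
`|∂Φ + Φ ∂S|²`). [folklore] -/
theorem norm_sq_add_mul_ofReal (z w : ℂ) (s : ℝ) :
    ‖z + w * (s : ℂ)‖ ^ 2 = ‖z‖ ^ 2 + 2 * s * ⟪w, z⟫_ℝ + s ^ 2 * ‖w‖ ^ 2 := by
  simp only [Complex.sq_norm, Complex.normSq_apply, Complex.inner, Complex.add_re, Complex.add_im,
    Complex.mul_re, Complex.mul_im, Complex.ofReal_re, Complex.ofReal_im, Complex.conj_re,
    Complex.conj_im]
  ring

/-- The partial derivative of `‖Φ‖²` along `e_{i,a}`: `∂_{i,a} ‖Φ‖² = 2 ⟪Φ, ∂_{i,a} Φ⟫_ℝ`.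
[folklore] -/
theorem pderiv_norm_sq {Φ : Config N → ℂ} {X : Config N} (hΦ : DifferentiableAt ℝ Φ X)
    (i : Fin N) (a : Fin 3) :
    pderiv i a (fun Y => ‖Φ Y‖ ^ 2) X = 2 * ⟪Φ X, fderiv ℝ Φ X 𝐞[i, a]⟫_ℝ := by
  rw [pderiv, (hΦ.hasFDerivAt.norm_sq).fderiv, smul_apply,
    ContinuousLinearMap.comp_apply, innerSL_apply_apply, nsmul_eq_mul, Nat.cast_ofNat]


/-- Pointwise expansion of the "covariant" kinetic density: for `Φ` differentiable at `X`,
`∑_{i,a} |∂_{i,a}Φ + Φ ∂_{i,a}S|² = |∇Φ|² + ∑_{i,a} ∂_{i,a}S ∂_{i,a}|Φ|² + |∇S|² |Φ|²` at `X`.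
[folklore] -/
theorem sum_norm_sq_covDeriv_eq {Φ : Config N → ℂ} {S : Config N → ℝ} {X : Config N}
    (hΦ : DifferentiableAt ℝ Φ X) :
    (∑ i : Fin N, ∑ a : Fin 3, ‖fderiv ℝ Φ X 𝐞[i, a] + Φ X * (pderiv i a S X : ℂ)‖ ^ 2) =
      kineticDensityReal Φ X +
        (∑ i : Fin N, ∑ a : Fin 3, pderiv i a S X * pderiv i a (fun Y => ‖Φ Y‖ ^ 2) X) +
        gradDot S S X * ‖Φ X‖ ^ 2 := by
  simp only [norm_sq_add_mul_ofReal, pderiv_norm_sq hΦ, kineticDensityReal, gradDot,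
    Finset.sum_add_distrib, Finset.sum_mul]
  congr 1
  · congr 1
    exact Finset.sum_congr rfl fun i _ => Finset.sum_congr rfl fun a _ => by ring
  · exact Finset.sum_congr rfl fun i _ => Finset.sum_congr rfl fun a _ => by ring

/-- One integration by parts on the torus: `∫ ∂_{i,a}S ∂_{i,a}|Φ|² = -∫ |Φ|² ∂_{i,a}∂_{i,a}S` for
`S ∈ C²` lattice periodic and `Φ ∈ C¹` periodic (the flux `|Φ|² ∂_{i,a}S` is a `C¹` periodic
function, `integral_cellN_pderiv_eq_zero`). [folklore] -/
theorem integral_pderiv_mul_pderiv_norm_sq (hL : 0 < L) {S : Config N → ℝ} (hS : ContDiff ℝ 2 S)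
    (hSper : IsLatticePeriodic L S) {Φ : Config N → ℂ} (hΦ : ContDiff ℝ 1 Φ)
    (hΦper : IsTorusPeriodic L Φ) (i : Fin N) (a : Fin 3) :
    ∫ X in cellN N L, pderiv i a S X * pderiv i a (fun Y => ‖Φ Y‖ ^ 2) X =
      -∫ X in cellN N L, ‖Φ X‖ ^ 2 * pderiv i a (pderiv i a S) X := by
  have hn : ContDiff ℝ 1 (fun Y => ‖Φ Y‖ ^ 2) := hΦ.norm_sq ℝ
  have hdS : ContDiff ℝ 1 (pderiv i a S) := contDiff_one_pderiv hS i a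
  -- the flux and its derivative
  set G : Config N → ℝ := fun Y => ‖Φ Y‖ ^ 2 * pderiv i a S Y with hG
  have hGc : ContDiff ℝ 1 G := hn.mul hdS
  have hGper : IsLatticePeriodic L G := fun Y j l => by
    simp only [hG, hΦper Y j l, (hSper.pderiv i a) Y j l]
  have h0 := integral_cellN_pderiv_eq_zero hL hGc hGper i a
  have hderiv : ∀ Y, pderiv i a G Y =
      ‖Φ Y‖ ^ 2 * pderiv i a (pderiv i a S) Y + pderiv i a S Y * pderiv i a (fun Z => ‖Φ Z‖ ^ 2) Y :=
    fun Y => pderiv_fun_mul ((hn.differentiable one_ne_zero) Y) ((hdS.differentiable one_ne_zero) Y) i a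
  simp_rw [hderiv] at h0
  have h1 : IntegrableOn (fun Y => ‖Φ Y‖ ^ 2 * pderiv i a (pderiv i a S) Y) (cellN N L) volume :=
    integrableOn_cellN (hn.continuous.mul (continuous_pderiv hdS i a)) L
  have h2 : IntegrableOn (fun Y => pderiv i a S Y * pderiv i a (fun Z => ‖Φ Z‖ ^ 2) Y) (cellN N L)
      volume :=
    integrableOn_cellN ((continuous_pderiv (hS.of_le (by norm_num)) i a).mul (continuous_pderiv hn i a)) L
  rw [integral_add h1 h2] at h0
  linarith

/-- **Ground-state representation on the torus, logarithmic variables.** For `S ∈ C²` lattice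
periodic and `Φ ∈ C¹` periodic (complex),
`∫_{cell} ∑_{i,a} |∂_{i,a}Φ + Φ ∂_{i,a}S|² = ∫_{cell} |∇Φ|² - ∫_{cell} (ΔS - |∇S|²) |Φ|²`:
the kinetic energy of `Φ` exceeds the "local kinetic energy" `-(Δe^{-S})/e^{-S} = ΔS - |∇S|²` of
the positive function `e^{-S}`, integrated against `|Φ|²`, by the (nonnegative) Dirichlet energy of
`Φ e^{S}` in the measure `e^{-2S} dX` (Jacobi / Barta / Bakry–Émery ground-state transform; no
division is needed in logarithmic variables). [folklore] -/
theorem integral_sum_norm_sq_covDeriv (hL : 0 < L) {S : Config N → ℝ} (hS : ContDiff ℝ 2 S)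
    (hSper : IsLatticePeriodic L S) {Φ : Config N → ℂ} (hΦ : ContDiff ℝ 1 Φ)
    (hΦper : IsTorusPeriodic L Φ) :
    ∫ X in cellN N L, (∑ i : Fin N, ∑ a : Fin 3, ‖fderiv ℝ Φ X 𝐞[i, a] + Φ X * (pderiv i a S X : ℂ)‖ ^ 2) =
      (∫ X in cellN N L, kineticDensityReal Φ X) -
        ∫ X in cellN N L, localKinetic S X * ‖Φ X‖ ^ 2 := by
  have hΦd : Differentiable ℝ Φ := hΦ.differentiable one_ne_zero
  have hn : ContDiff ℝ 1 (fun Y => ‖Φ Y‖ ^ 2) := hΦ.norm_sq ℝ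
  have hS1 : ContDiff ℝ 1 S := hS.of_le (by norm_num)
  simp_rw [sum_norm_sq_covDeriv_eq (hΦd _)]
  -- integrability of the three pieces
  have hkin : IntegrableOn (fun X => kineticDensityReal Φ X) (cellN N L) volume :=
    integrableOn_cellN (continuous_kineticDensityReal hΦ) L
  have hmid : IntegrableOn (fun X => ∑ i : Fin N, ∑ a : Fin 3,
      pderiv i a S X * pderiv i a (fun Y => ‖Φ Y‖ ^ 2) X) (cellN N L) volume :=
    integrableOn_cellN (continuous_finsetSum _ fun i _ => continuous_finsetSum _ fun a _ =>
      (continuous_pderiv hS1 i a).mul (continuous_pderiv hn i a)) L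
  have hlast : IntegrableOn (fun X => gradDot S S X * ‖Φ X‖ ^ 2) (cellN N L) volume :=
    integrableOn_cellN ((continuous_gradDot hS1 hS1).mul hn.continuous) L
  have hkm : IntegrableOn (fun X => kineticDensityReal Φ X + ∑ i : Fin N, ∑ a : Fin 3,
      pderiv i a S X * pderiv i a (fun Y => ‖Φ Y‖ ^ 2) X) (cellN N L) volume := hkin.add hmid
  rw [integral_add hkm hlast, integral_add hkin hmid]
  -- the middle term, by parts
  have hmid_eq : ∫ X in cellN N L, (∑ i : Fin N, ∑ a : Fin 3,
      pderiv i a S X * pderiv i a (fun Y => ‖Φ Y‖ ^ 2) X) =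
      -∫ X in cellN N L, configLaplacian S X * ‖Φ X‖ ^ 2 := by
    have hint : ∀ i a, IntegrableOn (fun X => pderiv i a S X * pderiv i a (fun Y => ‖Φ Y‖ ^ 2) X)
        (cellN N L) volume := fun i a =>
      integrableOn_cellN ((continuous_pderiv hS1 i a).mul (continuous_pderiv hn i a)) L
    have hint2 : ∀ i a, IntegrableOn (fun X => ‖Φ X‖ ^ 2 * pderiv i a (pderiv i a S) X)
        (cellN N L) volume := fun i a =>
      integrableOn_cellN (hn.continuous.mul (continuous_pderiv (contDiff_one_pderiv hS i a) i a)) L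
    have step1 : ∫ X in cellN N L, (∑ i : Fin N, ∑ a : Fin 3,
        pderiv i a S X * pderiv i a (fun Y => ‖Φ Y‖ ^ 2) X) =
        ∑ i : Fin N, ∑ a : Fin 3, ∫ X in cellN N L,
          pderiv i a S X * pderiv i a (fun Y => ‖Φ Y‖ ^ 2) X := by
      rw [integral_finsetSum _ (fun i _ => integrable_finsetSum _ fun a _ => hint i a)]
      exact Finset.sum_congr rfl fun i _ => integral_finsetSum _ fun a _ => hint i a
    have step2 : ∫ X in cellN N L, configLaplacian S X * ‖Φ X‖ ^ 2 =
        ∑ i : Fin N, ∑ a : Fin 3, ∫ X in cellN N L, ‖Φ X‖ ^ 2 * pderiv i a (pderiv i a S) X := by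
      have hpt : ∀ X, configLaplacian S X * ‖Φ X‖ ^ 2 =
          ∑ i : Fin N, ∑ a : Fin 3, ‖Φ X‖ ^ 2 * pderiv i a (pderiv i a S) X := fun X => by
        simp only [configLaplacian, Finset.sum_mul]
        exact Finset.sum_congr rfl fun i _ => Finset.sum_congr rfl fun a _ => by ring
      simp_rw [hpt]
      rw [integral_finsetSum _ (fun i _ => integrable_finsetSum _ fun a _ => hint2 i a)]
      exact Finset.sum_congr rfl fun i _ => integral_finsetSum _ fun a _ => hint2 i a
    rw [step1, step2]
    simp only [integral_pderiv_mul_pderiv_norm_sq hL hS hSper hΦ hΦper, Finset.sum_neg_distrib]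
  rw [hmid_eq]
  have hlk : ∫ X in cellN N L, localKinetic S X * ‖Φ X‖ ^ 2 =
      (∫ X in cellN N L, configLaplacian S X * ‖Φ X‖ ^ 2) -
        ∫ X in cellN N L, gradDot S S X * ‖Φ X‖ ^ 2 := by
    have hi1 : IntegrableOn (fun X => configLaplacian S X * ‖Φ X‖ ^ 2) (cellN N L) volume :=
      integrableOn_cellN ((continuous_finsetSum _ fun i _ => continuous_finsetSum _ fun a _ =>
        continuous_pderiv (contDiff_one_pderiv hS i a) i a).mul hn.continuous) L
    rw [← integral_sub hi1 hlast]
    refine integral_congr_ae (Eventually.of_forall fun X => ?_)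
    simp only [localKinetic]
    ring
  rw [hlk]
  ring

end PolicyImprovement

end Summit.AtomisticToContinuum.BoseEinsteinCondensation.Theorems

end
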